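import Mathlib
import Summits.Ventures.HodgeRepro.Tier4.Common.AdelicDefs
import Summits.Ventures.HodgeRepro.Tier4.Common.AdelicPlaces
import Summits.Ventures.HodgeRepro.Tier4.Common.MixedPlaneKType
import Summits.Ventures.HodgeRepro.Tier4.Common.LocalTorus

/-!
# Tier4/Common/PlaceCommute — elements of `G(𝔸_k)` supported at different places COMMUTE; an element of `G(𝔸_k)` is
determined by its components

Blind re-derivation cell `pub-hodge-repro`, Tier 4 «prove the step» (README §9–§10), seat t4-typer-2 (gen 3).
Target tree path `lean/Summits/Ventures/HodgeRepro/Tier4/Common/PlaceCommute.lean`.  Mathlib + Common; no literature.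

WHY (S13877): the projector onto `kTypeSpace'`'s clause set is the composite of the per-place projectors
`kProj (localTorusAt' W w) ν_w χ_w` and of the level projector `kProj K ν_K 1`; `KTypeProjectorCompose` composes
projectors of subgroups that commute ELEMENTWISE.  The local tori at distinct infinite places and the finite-part
subgroups are supported at different places of `𝔸_k`, hence commute: that adelic fact is proved here from the
extensionality of the adele ring (`Prod.ext`, `funext`, `RestrictedProduct.ext`).

* `Ad.ext_of_components` — an adele is determined by its infinite and finite components;
* `GA.ext_of_components` — an element of `G(𝔸_k)` is determined by its components `GA.infiniteComponent`,
  `GA.finiteComponent`;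
* **`commute_of_isAtPlace_of_ne`** — `g` supported at `w`, `h` supported at `w' ≠ w` ⇒ `g * h = h * g`;
* **`commute_of_isAtPlace_of_isInFinitePart`** — `g` supported at an infinite place, `h` in the finite part ⇒
  `g * h = h * g`;
* `atPlace_commute_of_ne`, `localTorusAt_commute_of_ne`, `localTorusAt'_commute_of_ne`,
  `localTorusAt_commute_finitePart`, `localTorusAt'_commute_finitePart`, `localTorusAt'_commute_of_le_finitePart` —
  the subgroup forms (the `hcomm` of `KTypeProjectorCompose` by name; `levelK W N ≤ finitePart W` is
  `levelK_le_finitePart`).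

Nothing here says anything about the status of the Hodge conjecture for CM abelian varieties, which is NOT proved
(HC_CM is NOT proved by anyone in this repository).
-/

set_option autoImplicit false

noncomputable section

namespace Summit.Ventures.HodgeRepro.Tier4.Common

open NumberField IsDedekindDomain

section Ext

variable {k : Type} [Field k] [NumberField k]

/-- **An adele is determined by its components** at the infinite and the finite places. -/
theorem Ad.ext_of_components {a b : Ad k} (hinf : ∀ w : InfinitePlace k, adComponentInf k w a = adComponentInf k w b)
    (hfin : ∀ v : HeightOneSpectrum (𝓞 k), adComponentFin k v a = adComponentFin k v b) : a = b := by
  refine Prod.ext (funext fun w => hinf w) ?_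
  exact RestrictedProduct.ext _ _ fun v => hfin v

variable (W : PlaneData k)

/-- **An element of `G(𝔸_k)` is determined by its components.** -/
theorem GA.ext_of_components {g h : GA W}
    (hinf : ∀ w : InfinitePlace k, GA.infiniteComponent W w g = GA.infiniteComponent W w h)
    (hfin : ∀ v : HeightOneSpectrum (𝓞 k), GA.finiteComponent W v g = GA.finiteComponent W v h) : g = h := by
  apply Subtype.ext
  apply Units.ext
  ext i j
  apply Ad.ext_of_components
  · intro w
    have := congrArg (fun u : GL (Fin 4) w.Completion => (u : Matrix (Fin 4) (Fin 4) w.Completion) i j) (hinf w)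
    exact this
  · intro v
    have := congrArg (fun u : GL (Fin 4) (v.adicCompletion k) => (u : Matrix (Fin 4) (Fin 4) (v.adicCompletion k)) i j)
      (hfin v)
    exact this

end Ext

section Commute

variable {k : Type} [Field k] [NumberField k] (W : PlaneData k)

/-- **Elements supported at two different infinite places commute.** -/
theorem commute_of_isAtPlace_of_ne {w w' : InfinitePlace k} (hww' : w ≠ w') {g h : GA W} (hg : IsAtPlace W w g)
    (hh : IsAtPlace W w' h) : g * h = h * g := by
  apply GA.ext_of_components
  · intro u
    rw [map_mul, map_mul]
    by_cases hu : u = w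
    · subst hu
      rw [hh.2 u hww', mul_one, one_mul]
    · rw [hg.2 u hu, one_mul, mul_one]
  · intro v
    rw [map_mul, map_mul, hg.1 v, hh.1 v]

/-- **An element supported at an infinite place commutes with the finite part.** -/
theorem commute_of_isAtPlace_of_isInFinitePart {w : InfinitePlace k} {g h : GA W} (hg : IsAtPlace W w g)
    (hh : IsInFinitePart W h) : g * h = h * g := by
  apply GA.ext_of_components
  · intro u
    rw [map_mul, map_mul, hh u, mul_one, one_mul]
  · intro v
    rw [map_mul, map_mul, hg.1 v, one_mul, mul_one]

/-- The subgroup form: `atPlace W w` and `atPlace W w'` commute elementwise for `w ≠ w'`. -/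
theorem atPlace_commute_of_ne {w w' : InfinitePlace k} (hww' : w ≠ w') :
    ∀ g ∈ atPlace W w, ∀ h ∈ atPlace W w', g * h = h * g :=
  fun _ hg _ hh => commute_of_isAtPlace_of_ne W hww' hg hh

/-- The local tori of `T` at two different places commute elementwise. -/
theorem localTorusAt_commute_of_ne {w w' : InfinitePlace k} (hww' : w ≠ w') :
    ∀ g ∈ localTorusAt W w, ∀ h ∈ localTorusAt W w', g * h = h * g :=
  fun _ hg _ hh => commute_of_isAtPlace_of_ne W hww' hg.2 hh.2

/-- The local tori of `T′` at two different places commute elementwise. -/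
theorem localTorusAt'_commute_of_ne {w w' : InfinitePlace k} (hww' : w ≠ w') :
    ∀ g ∈ localTorusAt' W w, ∀ h ∈ localTorusAt' W w', g * h = h * g :=
  fun _ hg _ hh => commute_of_isAtPlace_of_ne W hww' hg.2 hh.2

/-- The local torus of `T` at an infinite place commutes with the finite part. -/
theorem localTorusAt_commute_finitePart (w : InfinitePlace k) :
    ∀ g ∈ localTorusAt W w, ∀ h ∈ finitePart W, g * h = h * g :=
  fun _ hg _ hh => commute_of_isAtPlace_of_isInFinitePart W hg.2 hh

/-- The local torus of `T′` at an infinite place commutes with the finite part. -/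
theorem localTorusAt'_commute_finitePart (w : InfinitePlace k) :
    ∀ g ∈ localTorusAt' W w, ∀ h ∈ finitePart W, g * h = h * g :=
  fun _ hg _ hh => commute_of_isAtPlace_of_isInFinitePart W hg.2 hh

/-- The local torus of `T′` commutes with every subgroup of the finite part (e.g. the levels `levelK W N`,
`levelK_le_finitePart`). -/
theorem localTorusAt'_commute_of_le_finitePart (w : InfinitePlace k) {K : Subgroup (GA W)} (hK : K ≤ finitePart W) :
    ∀ g ∈ localTorusAt' W w, ∀ h ∈ K, g * h = h * g :=
  fun _ hg _ hh => commute_of_isAtPlace_of_isInFinitePart W hg.2 (hK hh)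

/-- The local torus of `T` commutes with every subgroup of the finite part. -/
theorem localTorusAt_commute_of_le_finitePart (w : InfinitePlace k) {K : Subgroup (GA W)} (hK : K ≤ finitePart W) :
    ∀ g ∈ localTorusAt W w, ∀ h ∈ K, g * h = h * g :=
  fun _ hg _ hh => commute_of_isAtPlace_of_isInFinitePart W hg.2 (hK hh)

end Commute

end Summit.Ventures.HodgeRepro.Tier4.Common

end
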